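import Mathlib.Topology.Algebra.Group.ClosedSubgroup
import Mathlib.Topology.Algebra.Group.Quotient
import Literature.AnabelianGeometry.SemiGraphs.ArithIntersectionWithGeometricProofs
import Literature.AnabelianGeometry.SemiGraphs.ArithQuasiGeometricOpenness
import HarnessLib

/-!
# [SemiAnbd] Theorem 5.4 (iii), clause 1: the containment of arithmetic decomposition groups FROM the
# geometric ones (sub-DAG SemiAnbd-Thm54, row T54-5, producer-side adapter; proof-only)

Mochizuki, *Semi-graphs of anabelioids*, Publ. RIMS **42** (2006), §5, p. 65 and Thm 5.4 (iii) p. 66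
[cite: MochizukiSemiAnbd2006, Thm 5.4 (iii), p. 66].  Print (p. 65): the arithmetic decomposition group
`Π^temp_{𝔊,v}` "may be thought of [cf. Cor 2.7 (i),(iii); Prop 3.6 (iii)] as the commensurator in
`Π^temp_𝔊` of `Π^temp_{𝔾,v} := Π^temp_{𝔊,v} ∩ Π^temp_𝔾`", and likewise `Π^temp_{𝔊,b}`.

This PROOF-ONLY file (no `def … : Prop`, nothing asserted) derives the per-representative input `(h2)` of
`ArithQuasiGeometricOpenness.lean` (abc-iut-w4-d106, p413272: `hV_of_compat` / `hE_of_compat`) — i.e.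
"`φ(Π^temp_{𝔊,v}) ⊆ g Π^temp_{ℍ,f v} g⁻¹` for some `g`, with geometric openness inside" — from data
that mention ONLY the geometric parts:
* the commensurator characterisation of p. 65 on both sides, in the currency of abc-iut-w4-d040's
  T54-2 file (`ArithIntersectionWithGeometricProofs.lean`): `C(Π^temp_{𝔊,v} ∩ Ker aug) = Π^temp_{𝔊,v}`
  (hypotheses `hcommV`, `hcommB`, `hcommV'`, `hcommB'` — for the producer of row T54-0,
  `decompositionDataOfChart`, they are the content of Cor 2.7 (i)/(iii) + total arithmetic
  estrangement + no branch switching, menu items H-CT / hconj; INPUTS here);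
* Rmk 5.3.1, first sentence, on the target side (`VerticialEdgeLikeCompactAmpleStatement`, row T54-1,
  consumed BY NAME) and continuity of `aug'`;
* GEOMETRIC openness: `φ` maps `Π^temp_{𝔊,v} ∩ Ker aug` onto an open subgroup of
  `(g Π^temp_{ℍ,f v} g⁻¹) ∩ Ker aug'` for some `g` (Prop 3.6 (iv) / Thm 3.7 (iv) for the geometric
  components, transported along `Π^temp_𝔾 ↪ Π^temp_𝔊` — the producer's output; INPUT here).
The mechanism (`map_commensurator_le`, `commensurator_eq_of_mapsOnto`): a homomorphism maps the
commensurator of `A` into the commensurator of `φ(A)`, and a subgroup mapped onto an OPEN subgroup of a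
compact `M` has image commensurable with `M`, so the two commensurators agree
(Mathlib `Subgroup.Commensurable.eq`).  No side taken on [IUTchIII] Cor. 3.12.

Provenance: written and staged by abc-iut-w4-d106 (2026-08-26T00:16Z); filed for the parked seat by
abc-iut-w5-d141 with one dedup edit (the finite-index lemma is REUSED from `ArithQuasiGeometricOpenness.lean`).
-/

namespace Literature.AnabelianGeometry.SemiGraphs

open scoped Pointwise

universe u u' u'' w w'

namespace ArithOpenness

/-! ### Commensurators under homomorphisms -/

/-- Relative indices do not drop to `0` under a homomorphism: `[φK : φH ∩ φK] ∣ [K : H ∩ K]`-type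
bookkeeping (`(H.map φ).relIndex (K.map φ) = (H ⊔ Ker φ).relIndex K`, which divides `H.relIndex K`).
[cite: MochizukiSemiAnbd2006, §0, p. 5] -/
theorem relIndex_map_ne_zero {G G' : Type*} [Group G] [Group G'] (φ : G →* G') {H K : Subgroup G}
    (h : H.relIndex K ≠ 0) : (H.map φ).relIndex (K.map φ) ≠ 0 := by
  rw [← Subgroup.relIndex_comap, Subgroup.comap_map_eq]
  exact fun h0 => h (Nat.eq_zero_of_zero_dvd (h0 ▸ Subgroup.relIndex_dvd_of_le_left K le_sup_left))

/-- Commensurability is preserved by homomorphisms. [cite: MochizukiSemiAnbd2006, §0, p. 5] -/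
theorem commensurable_map {G G' : Type*} [Group G] [Group G'] (φ : G →* G') {H K : Subgroup G}
    (h : Subgroup.Commensurable H K) : Subgroup.Commensurable (H.map φ) (K.map φ) :=
  ⟨relIndex_map_ne_zero φ h.1, relIndex_map_ne_zero φ h.2⟩

/-- **A homomorphism maps the commensurator of `A` into the commensurator of `φ(A)`**
(`C_G(A) → C_{G'}(φ A)`; [SemiAnbd] §0 "Topological groups", p. 5, commensurator).
[cite: MochizukiSemiAnbd2006, §0, p. 5] -/
theorem map_commensurator_le {G G' : Type*} [Group G] [Group G'] (φ : G →* G') (A : Subgroup G) :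
    (Subgroup.Commensurable.commensurator A).map φ ≤ Subgroup.Commensurable.commensurator (A.map φ) := by
  rintro _ ⟨x, hx, rfl⟩
  rw [SetLike.mem_coe, Subgroup.Commensurable.commensurator_mem_iff] at hx
  rw [Subgroup.Commensurable.commensurator_mem_iff]
  have hmap : ConjAct.toConjAct (φ x) • A.map φ = (ConjAct.toConjAct x • A).map φ := by
    change conjSubgroup (φ x) (A.map φ) = (conjSubgroup x A).map φ
    rw [conjSubgroup, conjSubgroup, Subgroup.map_map, Subgroup.map_map]
    congr 1
    ext y
    simp [MulAut.conj_apply]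
  rw [hmap]
  exact commensurable_map φ hx

/-- **A subgroup mapped onto an open subgroup of a compact `M` has image with the same commensurator as
`M`** (its image is of finite index in `M`, hence commensurable with `M`; commensurable subgroups have
equal commensurators). [cite: MochizukiSemiAnbd2006, §0, p. 5] -/
theorem commensurator_eq_of_mapsOnto {G G' : Type*} [Group G] [Group G'] [TopologicalSpace G']
    [IsTopologicalGroup G'] (φ : G →* G') {A : Subgroup G} {M : Subgroup G'}
    (hM : IsCompact (M : Set G')) (h : MapsOntoOpenSubgroupOf φ A M) :
    Subgroup.Commensurable.commensurator (A.map φ) = Subgroup.Commensurable.commensurator M := by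
  apply Subgroup.Commensurable.eq
  haveI : CompactSpace M := isCompact_iff_compactSpace.mp hM
  have hopen : IsOpen (((A.map φ).subgroupOf M : Subgroup M) : Set M) := by
    rw [Subgroup.coe_subgroupOf]
    exact h.2
  refine ⟨(finiteIndex_of_isOpen_of_compactSpace _ hopen).index_ne_zero, ?_⟩
  rw [Subgroup.relIndex_eq_one.mpr h.1]
  exact one_ne_zero

end ArithOpenness

/-! ### Row T54-5, producer-side input `(h2)`: containment of the arithmetic decomposition groups -/

section Adapter

variable {Gtp : Type u} [Group Gtp] [TopologicalSpace Gtp]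
variable {Htp : Type u''} [Group Htp] [TopologicalSpace Htp] [IsTopologicalGroup Htp] [T2Space Htp]
variable {PA : Type u'} [Group PA] [TopologicalSpace PA] [T1Space PA]
variable {V : Type w} {B : Type w'} {V' : Type*} {B' : Type*}
variable {D : DecompositionData Gtp V B} {D' : DecompositionData Htp V' B'}
variable {aug : Gtp →* PA} {aug' : Htp →* PA} {φ : Gtp →* Htp}

omit [TopologicalSpace Gtp] in
/-- **The mechanism**, for one pair of groups: if `K = C(K ∩ Ker aug)`, `M = C(M ∩ Ker aug')` (p. 65),
`M` is compact and `φ` maps `K ∩ Ker aug` onto an open subgroup of `M ∩ Ker aug'`, then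
`φ(K) ⊆ M`. [cite: MochizukiSemiAnbd2006, Thm 5.4 (iii), p. 66] -/
theorem map_le_of_geomOpen (haug' : Continuous aug') {K : Subgroup Gtp} {M : Subgroup Htp}
    (hK : Subgroup.Commensurable.commensurator (K ⊓ aug.ker) = K)
    (hM : Subgroup.Commensurable.commensurator (M ⊓ aug'.ker) = M) (hMc : IsCompact (M : Set Htp))
    (hgeom : MapsOntoOpenSubgroupOf φ (K ⊓ aug.ker) (M ⊓ aug'.ker)) : K.map φ ≤ M := by
  have hMker : IsCompact ((M ⊓ aug'.ker : Subgroup Htp) : Set Htp) := by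
    refine hMc.of_isClosed_subset ?_ inf_le_left
    change IsClosed ((M : Set Htp) ∩ (aug'.ker : Set Htp))
    refine hMc.isClosed.inter ?_
    rw [MonoidHom.coe_ker]
    exact isClosed_singleton.preimage haug'
  calc K.map φ = (Subgroup.Commensurable.commensurator (K ⊓ aug.ker)).map φ := by rw [hK]
    _ ≤ Subgroup.Commensurable.commensurator ((K ⊓ aug.ker).map φ) :=
      ArithOpenness.map_commensurator_le φ _
    _ = Subgroup.Commensurable.commensurator (M ⊓ aug'.ker) :=
      ArithOpenness.commensurator_eq_of_mapsOnto φ hMker hgeom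
    _ = M := hM

omit [TopologicalSpace Gtp] in
/-- **`(h2)` for vertices from geometric data** (the verticial input `hv` of `hV_of_compat`, p413272):
from the commensurator characterisation of p. 65 on both sides (`hcommV`, `hcommV'` — the currency of
`commensurator_inf_ker_eq_of_isVerticial`, row T54-2), Rmk 5.3.1 first sentence on the target (row
T54-1), continuity of `aug'`, and, per vertex, GEOMETRIC openness of `φ` on `Π^temp_{𝔊,v} ∩ Ker aug`
inside the geometric part of a conjugate of `Π^temp_{ℍ,f v}`.
[cite: MochizukiSemiAnbd2006, Thm 5.4 (iii), p. 66] -/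
theorem hv_of_geomOpen (haug' : Continuous aug')
    (hcommV : ∀ v : V, Subgroup.Commensurable.commensurator (D.vertGp v ⊓ aug.ker) = D.vertGp v)
    (hcommV' : ∀ v' : V', Subgroup.Commensurable.commensurator (D'.vertGp v' ⊓ aug'.ker) = D'.vertGp v')
    (hH : VerticialEdgeLikeCompactAmpleStatement D' aug') (f : V → V')
    (hgeo : ∀ v : V, ∃ g : Htp,
      MapsOntoOpenSubgroupOf φ (D.vertGp v ⊓ aug.ker) (conjSubgroup g (D'.vertGp (f v)) ⊓ aug'.ker)) :
    ∀ v : V, ∃ g : Htp, (D.vertGp v).map φ ≤ conjSubgroup g (D'.vertGp (f v)) ∧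
      MapsOntoOpenSubgroupOf φ (D.vertGp v ⊓ aug.ker) (conjSubgroup g (D'.vertGp (f v)) ⊓ aug'.ker) := by
  intro v
  obtain ⟨g, hg⟩ := hgeo v
  refine ⟨g, map_le_of_geomOpen haug' (hcommV v) ?_ ?_ hg, hg⟩
  · exact commensurator_inf_ker_eq_of_isVerticial D' aug' hcommV' ⟨f v, g, rfl⟩
  · exact (hH _ (Or.inl ⟨f v, g, rfl⟩)).1

omit [TopologicalSpace Gtp] in
/-- **`(h2)` for branches from geometric data** (the edge-like input `hb` of `hE_of_compat`, p413272):
the same with the decomposition groups of branches, from `hcommB`, `hcommB'` (the branch currency of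
row T54-2, `commensurator_inf_ker_eq_of_isEdgeLike`: "`Π^temp_{𝔊,b}` … the commensurator … of
`Π^temp_{𝔾,b}`", p. 65 — for the produced data this is where total arithmetic estrangement and the
no-branch-switching hypothesis of Thm 5.4 enter, menu H-CT/hconj; INPUT here), Rmk 5.3.1 on the target,
and GEOMETRIC openness per branch. [cite: MochizukiSemiAnbd2006, Thm 5.4 (iii), p. 66] -/
theorem hb_of_geomOpen (haug' : Continuous aug')
    (hcommB : ∀ b : B, Subgroup.Commensurable.commensurator (D.brGp b ⊓ aug.ker) = D.brGp b)
    (hcommB' : ∀ b' : B', Subgroup.Commensurable.commensurator (D'.brGp b' ⊓ aug'.ker) = D'.brGp b')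
    (hH : VerticialEdgeLikeCompactAmpleStatement D' aug') (fb : B → B')
    (hgeo : ∀ b : B, ∃ g : Htp,
      MapsOntoOpenSubgroupOf φ (D.brGp b ⊓ aug.ker) (conjSubgroup g (D'.brGp (fb b)) ⊓ aug'.ker)) :
    ∀ b : B, ∃ g : Htp, (D.brGp b).map φ ≤ conjSubgroup g (D'.brGp (fb b)) ∧
      MapsOntoOpenSubgroupOf φ (D.brGp b ⊓ aug.ker) (conjSubgroup g (D'.brGp (fb b)) ⊓ aug'.ker) := by
  intro b
  obtain ⟨g, hg⟩ := hgeo b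
  refine ⟨g, map_le_of_geomOpen haug' (hcommB b) ?_ ?_ hg, hg⟩
  · exact commensurator_inf_ker_eq_of_isEdgeLike D' aug' hcommB' ⟨fb b, g, rfl⟩
  · exact (hH _ (Or.inr ⟨fb b, g, rfl⟩)).1

end Adapter

end Literature.AnabelianGeometry.SemiGraphs
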